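import Summits.QuantumFields.YangMills.Theorems.BalabanUVNodesN21ShellSplitOfRecord13CoPHDefs
import Summits.QuantumFields.YangMills.Theorems.BalabanUVNodesN19MGFRoadLiveSelectorTower
import Summits.QuantumFields.YangMills.Theorems.BalabanUVNodesN19MGFFormAtRecord
import Summits.QuantumFields.YangMills.Theorems.BalabanUVNodesN14BinderAtSpineReadingOfRecord13CoPH

/-!
# BalabanUVNodes ∕ N14 — n21-d's SHELL SPLIT OF RECORD IN MGF-PART FORM: the SHELL MEASURES of slots (`≤` the class measures), N21's term shell part
# `shellWeightOfDatum₉` IS an MGF over them, hence `MGFForm` of the keyed shell parts `shellA₁₃ ∕ shellB₁₃` at the spine reading of record — and p593287 §4 with its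
# (SH) letters DISCHARGED at `sh := shellSplitOfRecord₁₃At N K₀ ρA ρB`: N19′ ∧ U4′ at the reading from (V) + U3's TV sentence ONLY

Cell `pub-ymgap` (HUMAN RULING D-0062 Track A; director-ym №197 ∕ HUMAN RULING D-0149), WIDTH SEAT `pub-ymgap-dag-n14-w2` (g2), INTENT-2 (INBOX l.26298) after p593287
`…N14BinderAtSpineReadingOfRecord13CoPH` (this seat).  Filed `--kind proof --supports stmt-QuantumFields-20544 --as helper` (K3⁷ `SpineGivenEndpointR13SepCoPH`).  COUNT-NEUTRAL.
Imports dag-n21-d's DEFINITION LANE `…N21ShellSplitOfRecord13CoPHDefs` (`shellWeightOfDatum₉`, `shellA₁₃ ∕ shellB₁₃`, `shellSplitOfRecord₁₃At`), dag-n19-c's `…N19MGFRoadLiveSelectorTower`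
(`dressedSlotsOfDatum₉_ppSelLive_eq_ppSelId`), dag-n19-d's module A ∕ MODULE B (`texpAOfRecordFrom_eq_toReal_lintegral_slotMeasure`, `slotMeasure`, `classMeasureOfSlots`,
`measurable_slotMeasure`, `slotMeasure_univ_lt_top`, `wOfRecord₉_nonneg`), p593287 — all BY NAME; nothing of theirs re-declared; `N`- and `K₀`-generic; no Theses import.

WHY.  p593287 §4 produced N19′'s edge at the reading from (V) + (I) + (SH), (SH) = «the shell split `sh` is in MGF-PART form»: `MGFForm 1 … νshA (sh …).1` with `νshA ≤ classMeasA₁₃`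
(idem B) — a hypothesis about NODE O ∕ N21's object.  dag-n21-d TYPED that object: the shell split OF RECORD `shellSplitOfRecord₁₃At K₀ ρA ρB` (R5's one residual reading of
`crOfRecord₁₃At` INHABITED), whose term shell part is `shellWeightOfDatum₉ … ρ t s = ∫ χ_k^{ε_k}(s)·(1 − χ_k^{ε_k(1−ρ)}(s))·slot^t_k(s) dV_k` ([LF-I] p.193's mechanism as the term's own
shell part).  Since module A's tower is positive-LINEAR in the dressing (`texpAOfRecordFrom_eq_toReal_lintegral_slotMeasure`), that integral IS the MGF of the record's observable over
the class measure with its top density `χ_k(s)` lowered to `χ_k(s)·(1 − χ_k^{ε_k(1−ρ)}(s)) ∈ [0, χ_k(s)]` — a SUB-measure.  So (SH) is a THEOREM at the shell split of record.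
* §1 GENERIC (module A's letters): `shellMeasureOfSlots … b k ε' s` (1 def) · `shellDensity_nonneg ∕ _le` · ★ `shellMeasureOfSlots_le` (`≤ classMeasureOfSlots`, `withDensity_mono` +
  `Measure.bind`) · `lintegral_shellMeasureOfSlots` · ★ `integral_shellDensity_mul_texpAOfRecordFrom_eq_mgf` (identity selector at positive levels; start `e^{t·Fo}·b`).
* §2 AT F3's DATA: ★ `shellWeightOfDatum₉_eq_mgf_of_ppSelId` · `shellWeightOfDatum₉_ppSelLive_eq_ppSelId` (tower identity) · ★ `shellWeightOfDatum₉_eq_mgf_of_ppSelLive`.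
* §3 AT THE READING: `shellMeasA₁₃ ∕ shellMeasB₁₃` (2 defs: fibre sums along `keyA₁₃ ∕ keyB₁₃` at the lowered thresholds `ε_{K₀+K}(1 − ρ K)` ∕ `ε_{K₀+K+1}(1 − ρ K)`) ·
  `shellMeasA₁₃_le ∕ shellMeasB₁₃_le` (= p593287's `hleA ∕ hleB`) · `isFiniteMeasure_shellMeasA₁₃ ∕ B₁₃` · ★ `mgfForm_shellA₁₃ ∕ mgfForm_shellB₁₃` (= p593287's `hshA ∕ hshB` at
  `sh := shellSplitOfRecord₁₃At N K₀ ρA ρB`, `ρ := ρA∕ρB F θ hP g₀ os`; live selector, laws as p593287) · ★★ `core_crOfRecord₁₃At_shellSplitOfRecord_of_coreZero_of_tv`: N19′ ∧ U4′ AT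
  `crOfRecord₁₃At K₀ jcut (shellSplitOfRecord₁₃At N K₀ ρA ρB)` from (V) + U3's TV sentence on the shell-free laws ONLY.

HONEST FRAMING.  Count-neutral [folklore] measure arithmetic on n21-d's DEFINITIONS (no estimate: their per-cube (M1) ∕ `ShellWeightBound` companion is NOT touched, NE7c NOT
PRINTED ∕ NOT proved); (V) and U3's (I) remain HYPOTHESIS SHAPES produced by nobody — UNPRINTED two-run statements for d = 4; the live-selector pin and the laws are displayed, claimed
for no tuple (K0⁷ OPEN); nothing of Bałaban's asserted; NE7 ∕ NE1′ NOT PRINTED ∕ NOT PROVED; N14 ∕ N19 ∕ N21 NOT discharged; K3⁷ OPEN, NOT claimed; counts UNMOVED (typed 28∕28 ·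
discharged 5∕27, A 5∕28); one finite four-torus programme at fixed `ε = L^{−K}`, Bałaban AS PRINTED — the YM mass gap (Clay) is NOT proved by any of this: R4 closes only the conditional
finite-𝕋⁴ rung `BalabanLadder.UV`; NOT ℝ⁴, NOT OS, NOT a mass gap, NOT Clay.  3 `def` (measure-level record objects), 0 `sorry`, standard axioms, no `instance`, no `notation`; no decl
below carries a cite tag (shape references: [Balaban1988Convergent] (2.17)–(2.18) p.257, [Balaban1989LargeFieldI] (0.3) p.176, p.193 — NAMES only).
-/

set_option autoImplicit false

noncomputable section
open MeasureTheory ProbabilityTheory Finset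
open scoped ENNReal BigOperators Matrix.Norms.L2Operator

namespace YMDAG.N14.AtSpineReading13CoPH.Shell

open Literature.MathematicalPhysics.QuantumFieldTheory.Balaban1983to89
open Literature.MathematicalPhysics.QuantumFieldTheory.Balaban1983to89.T4Continuum
open Literature.MathematicalPhysics.QuantumFieldTheory.Balaban1983to89.Node00
open Literature.MathematicalPhysics.QuantumFieldTheory.Balaban1983to89.T4DressedR (exp_dressing_bounds)
open B14.Eq218Concrete
open Summit.QuantumFields.YangMills.BalabanUVNodes.N19MGFKernelTower

/-! ## §1 Generic: the SHELL MEASURE of slots (top density `χ_k(s)·(1 − χ_k^{ε'}(s))`), `≤` the class measure, and its MGF identity -/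

section Generic

variable {F : T4Family} {N : ℕ} [NeZero N] {ν : Stage7Numerics} {τ : TowerNumerics}
variable {w : StepWeightsOfRecord F N ν τ.M} {p : B12.RunParams} {g : ℕ → ℝ}

variable (F N ν τ w p g) in
/-- **THE SHELL MEASURE OF SLOTS** of the sequence `s` at level `k` and lowered threshold letter `ε'`: module A's class measure with the top density `χ_k(s)` replaced
by `χ_k(s)·(1 − χ_k^{ε'}(s))` («every top cube passes at the threshold of record, some top cube fails at `ε'`») — the measure whose MGF is N21's term shell part. [bookkeeping] -/
def shellMeasureOfSlots (b : GaugeField (F.P p.K) 0 (Node00.SU N) → ℝ) (k : ℕ) (ε' : ℝ) (s : SeqOfRecord F ν τ.M g p.K k) :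
    Measure (GaugeField (F.P p.K) 0 (Node00.SU N)) :=
  ((fieldMeasure (F.P p.K) k (Node00.SU N)).withDensity fun V =>
      ENNReal.ofReal (chiSeqOfRecord F N ν τ.M g p.K k s V * (1 - chiSeqOfRecordAt F N ν τ.M g p.K k ε' s V))).bind
    (slotMeasure F N ν τ w p g b k s)

/-- The shell density is at most the class density: `χ·(1 − χ') ≤ χ` (`0 ≤ χ`, `0 ≤ χ'`). [folklore] -/
theorem shellDensity_le (k : ℕ) (ε' : ℝ) (s : SeqOfRecord F ν τ.M g p.K k) (V : GaugeField (F.P p.K) k (Node00.SU N)) :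
    chiSeqOfRecord F N ν τ.M g p.K k s V * (1 - chiSeqOfRecordAt F N ν τ.M g p.K k ε' s V) ≤ chiSeqOfRecord F N ν τ.M g p.K k s V :=
  mul_le_of_le_one_right (chiSeqOfRecord_nonneg F N ν τ.M g p.K k s V) (sub_le_self _ (chiSeqOfRecordAt_nonneg F N ν τ.M g p.K k ε' s V))
/-- … and non-negative. [folklore] -/
theorem shellDensity_nonneg (k : ℕ) (ε' : ℝ) (s : SeqOfRecord F ν τ.M g p.K k) (V : GaugeField (F.P p.K) k (Node00.SU N)) :
    0 ≤ chiSeqOfRecord F N ν τ.M g p.K k s V * (1 - chiSeqOfRecordAt F N ν τ.M g p.K k ε' s V) :=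
  mul_nonneg (chiSeqOfRecord_nonneg F N ν τ.M g p.K k s V) (sub_nonneg.2 (chiSeqOfRecordAt_le_one F N ν τ.M g p.K k ε' s V))

/-- **THE SHELL MEASURE IS A PART OF THE CLASS MEASURE**: `shellMeasureOfSlots … ≤ classMeasureOfSlots …` (smaller top density, same kernel). [folklore] -/
theorem shellMeasureOfSlots_le
    (hwm : ∀ k s', Measurable fun z : GaugeField (F.P p.K) (k + 1) (Node00.SU N) × GaugeField (F.P p.K) k (Node00.SU N) => w p g k s' z.2 z.1)
    (hχm : ∀ k s, Measurable (chiSeqOfRecord F N ν τ.M g p.K k s)) {b : GaugeField (F.P p.K) 0 (Node00.SU N) → ℝ} (hbm : Measurable b)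
    (k : ℕ) (ε' : ℝ) (s : SeqOfRecord F ν τ.M g p.K k) :
    shellMeasureOfSlots F N ν τ w p g b k ε' s ≤ classMeasureOfSlots F N ν τ w p g b k s := by
  have hQm : Measurable (slotMeasure F N ν τ w p g b k s) := measurable_slotMeasure hwm hχm hbm k s
  refine Measure.le_iff.2 fun S hS => ?_
  unfold shellMeasureOfSlots classMeasureOfSlots
  rw [Measure.bind_apply hS hQm.aemeasurable, Measure.bind_apply hS hQm.aemeasurable]
  refine lintegral_mono' (withDensity_mono (ae_of_all _ fun V => ?_)) le_rfl
  exact ENNReal.ofReal_le_ofReal (shellDensity_le k ε' s V)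

/-- Integration against the shell measure: `∫ f d(shell_k(s)) = ∫ ofReal(χ_k(s)(V)·(1 − χ_k^{ε'}(s)(V))) · (∫ f d slotMeasure_k(s)(V)) dV_k` (`Measure.lintegral_bind` +
`withDensity`; module A's `lintegral_classMeasureOfSlots` with the shell density). [folklore] -/
theorem lintegral_shellMeasureOfSlots
    (hwm : ∀ k s', Measurable fun z : GaugeField (F.P p.K) (k + 1) (Node00.SU N) × GaugeField (F.P p.K) k (Node00.SU N) => w p g k s' z.2 z.1)
    (hχm : ∀ k s, Measurable (chiSeqOfRecord F N ν τ.M g p.K k s)) {b : GaugeField (F.P p.K) 0 (Node00.SU N) → ℝ} (hbm : Measurable b)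
    (k : ℕ) {ε' : ℝ} (s : SeqOfRecord F ν τ.M g p.K k) (hχm' : Measurable (chiSeqOfRecordAt F N ν τ.M g p.K k ε' s))
    {f : GaugeField (F.P p.K) 0 (Node00.SU N) → ℝ≥0∞} (hf : Measurable f) :
    ∫⁻ x, f x ∂(shellMeasureOfSlots F N ν τ w p g b k ε' s) =
      ∫⁻ V, ENNReal.ofReal (chiSeqOfRecord F N ν τ.M g p.K k s V * (1 - chiSeqOfRecordAt F N ν τ.M g p.K k ε' s V)) *
          ∫⁻ x, f x ∂(slotMeasure F N ν τ w p g b k s V) ∂(fieldMeasure (F.P p.K) k (Node00.SU N)) := by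
  have hQm : Measurable (slotMeasure F N ν τ w p g b k s) := measurable_slotMeasure hwm hχm hbm k s
  have hg : Measurable fun V => ∫⁻ x, f x ∂(slotMeasure F N ν τ w p g b k s V) := (Measure.measurable_lintegral hf).comp hQm
  have hdens : Measurable fun V => ENNReal.ofReal (chiSeqOfRecord F N ν τ.M g p.K k s V * (1 - chiSeqOfRecordAt F N ν τ.M g p.K k ε' s V)) :=
    ((hχm k s).mul (measurable_const.sub hχm')).ennreal_ofReal
  unfold shellMeasureOfSlots
  rw [Measure.lintegral_bind hQm.aemeasurable hf.aemeasurable, lintegral_withDensity_eq_lintegral_mul _ hdens hg]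
  rfl

/-- **THE SHELL WEIGHT OF THE EXPONENTIALLY DRESSED TOWER IS A MOMENT GENERATING FUNCTION** over the shell measure: for the start `e^{t·Fo}·b` (`|Fo| ≤ B`, `b ≥ 0`
measurable), identity selector at positive levels, step weights `0 ≤ w` jointly measurable, measurable `χ_k`, `χ_k^{ε'}`:
`∫ χ_k(s)·(1 − χ_k^{ε'}(s))·slot^t_k(s) dV_k = mgf Fo (shellMeasureOfSlots … k ε' s) t` — module A's `integral_chi_mul_texpAOfRecordFrom_eq_mgf` with the shell density (its
pointwise kernel representation `texpAOfRecordFrom_eq_toReal_lintegral_slotMeasure` BY NAME). [folklore] -/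
theorem integral_shellDensity_mul_texpAOfRecordFrom_eq_mgf {ppSel : PpSelOfRecord F ν τ.M}
    (hsel : ∀ (k : ℕ) (s : SeqOfRecord F ν τ.M g p.K (k + 1)), ppSel p g (k + 1) s = s)
    (hw0 : ∀ k s' U V', 0 ≤ w p g k s' U V')
    (hwm : ∀ k s', Measurable fun z : GaugeField (F.P p.K) (k + 1) (Node00.SU N) × GaugeField (F.P p.K) k (Node00.SU N) => w p g k s' z.2 z.1)
    (hχm : ∀ k s, Measurable (chiSeqOfRecord F N ν τ.M g p.K k s))
    {b : GaugeField (F.P p.K) 0 (Node00.SU N) → ℝ} (hbm : Measurable b) (hb0 : ∀ U, 0 ≤ b U)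
    {Fo : GaugeField (F.P p.K) 0 (Node00.SU N) → ℝ} (hFm : Measurable Fo) {B : ℝ} (hFb : ∀ U, |Fo U| ≤ B) (t : ℝ)
    {start : (p : B12.RunParams) → (ℕ → ℝ) → Density (F.P p.K) 0 (Node00.SU N)} (hstart : ∀ U, start p g U = Real.exp (t * Fo U) * b U)
    (k : ℕ) {ε' : ℝ} (s : SeqOfRecord F ν τ.M g p.K k) (hχm' : Measurable (chiSeqOfRecordAt F N ν τ.M g p.K k ε' s)) :
    ∫ V, chiSeqOfRecord F N ν τ.M g p.K k s V * (1 - chiSeqOfRecordAt F N ν τ.M g p.K k ε' s V) *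
          texpAOfRecordFrom F N ν τ.M start w (rstepSlotOfRecord F N ν τ ppSel) p g k s V ∂(fieldMeasure (F.P p.K) k (Node00.SU N)) =
      ProbabilityTheory.mgf Fo (shellMeasureOfSlots F N ν τ w p g b k ε' s) t := by
  have hgm : Measurable fun U => Real.exp (t * Fo U) := Real.measurable_exp.comp (hFm.const_mul t)
  have hrep := texpAOfRecordFrom_eq_toReal_lintegral_slotMeasure hsel hw0 hwm hχm hbm hb0 (gd := fun U => Real.exp (t * Fo U)) hgm
    (Real.exp_pos _) (Real.exp_pos _).le (fun U => (exp_dressing_bounds hFb t U).1) (fun U => (exp_dressing_bounds hFb t U).2) hstart k s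
  have hQm : Measurable (slotMeasure F N ν τ w p g b k s) := measurable_slotMeasure hwm hχm hbm k s
  have hG : Measurable fun V => ∫⁻ x, ENNReal.ofReal (Real.exp (t * Fo x)) ∂(slotMeasure F N ν τ w p g b k s V) :=
    (Measure.measurable_lintegral hgm.ennreal_ofReal).comp hQm
  have hGfin : ∀ V, ∫⁻ x, ENNReal.ofReal (Real.exp (t * Fo x)) ∂(slotMeasure F N ν τ w p g b k s V) < ∞ := fun V =>
    (lintegral_mono fun x => ENNReal.ofReal_le_ofReal (exp_dressing_bounds hFb t x).2).trans_lt
      (by rw [lintegral_const]; exact ENNReal.mul_lt_top ENNReal.ofReal_lt_top (slotMeasure_univ_lt_top b k s V))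
  have hTf : texpAOfRecordFrom F N ν τ.M start w (rstepSlotOfRecord F N ν τ ppSel) p g k s =
      fun V => (∫⁻ x, ENNReal.ofReal (Real.exp (t * Fo x)) ∂(slotMeasure F N ν τ w p g b k s V)).toReal := funext hrep
  have hd0 := shellDensity_nonneg (N := N) (τ := τ) k ε' s
  have hdm : Measurable fun V => chiSeqOfRecord F N ν τ.M g p.K k s V * (1 - chiSeqOfRecordAt F N ν τ.M g p.K k ε' s V) :=
    (hχm k s).mul (measurable_const.sub hχm')
  rw [hTf, integral_eq_lintegral_of_nonneg_ae (ae_of_all _ fun V => mul_nonneg (hd0 V) ENNReal.toReal_nonneg)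
    ((hdm.mul hG.ennreal_toReal).aestronglyMeasurable), ProbabilityTheory.mgf,
    integral_eq_lintegral_of_nonneg_ae (ae_of_all _ fun x => (Real.exp_pos _).le) hgm.aestronglyMeasurable,
    lintegral_shellMeasureOfSlots hwm hχm hbm k s hχm' hgm.ennreal_ofReal]
  congr 1
  refine lintegral_congr fun V => ?_
  rw [ENNReal.ofReal_mul (hd0 V), ENNReal.ofReal_toReal (hGfin V).ne]

end Generic

/-! ## §2 At F3's data: N21's term shell part `shellWeightOfDatum₉` IS an MGF over the shell measure of slots (identity selector; live selector by the tower identity) -/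

section AtData

open Summit.QuantumFields.YangMills.Theorems.N21ShellSplitOfRecord13CoPH (shellWeightOfDatum₉)
open Summit.QuantumFields.YangMills.BalabanUVNodes.N19MGFRoadLiveSelectorTower (dressedSlotsOfDatum₉_ppSelLive_eq_ppSelId)

variable {F : T4Family} {N : ℕ} [NeZero N]

/-- **★ N21's TERM SHELL PART IS AN MGF — AT THE IDENTITY SELECTOR, ALL `t`**: for a Stage-9 tuple `ϑ` with `ϑ.ppSel = ppSelIdOfRecord`, under the displayed laws of the
residual step weights (`0 ≤ wOfRecord₉ ϑ`, jointly measurable), measurable `χ_k` and `χ_k^{ε_k(1−ρ)}`, and a datum with measurable averagings: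
`shellWeightOfDatum₉ ϑ D g₀ os p g k ρ t s = mgf (prodObs (D.scheme g₀) p.K os) (shellMeasureOfSlots … (wOfRecord₉ ϑ) p g (e^{−A∕g₀²} start) k (ε_k(1−ρ)) s) t` (§1 at F3's
`dressedSlotsOfDatum₉`, start `e^{t·prodObs}·boltzmann`, `|prodObs| ≤ 1`). [folklore] -/
theorem shellWeightOfDatum₉_eq_mgf_of_ppSelId (ϑ : Stage9Params F N) (hsel : ϑ.ppSel = ppSelIdOfRecord F ϑ.ν ϑ.τ9.M) {p : B12.RunParams} {g : ℕ → ℝ}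
    (hw0 : ∀ k s' U V', 0 ≤ wOfRecord₉ F N ϑ p g k s' U V')
    (hwm : ∀ k s', Measurable fun z : GaugeField (F.P p.K) (k + 1) (Node00.SU N) × GaugeField (F.P p.K) k (Node00.SU N) => wOfRecord₉ F N ϑ p g k s' z.2 z.1)
    (hχm : ∀ k s, Measurable (chiSeqOfRecord F N ϑ.ν ϑ.τ9.M g p.K k s)) (D : FiniteEpsData F (Node00.SU N)) (hD : D.AvgMeasurable)
    (g₀ : ℕ → ℝ) (os : List (ULoop F)) (k : ℕ) (ρ t : ℝ) (s : SeqOfRecord F ϑ.ν ϑ.τ9.M g p.K k)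
    (hχm' : Measurable (chiSeqOfRecordAt F N ϑ.ν ϑ.τ9.M g p.K k (epsOfRecord ϑ.ν g k * (1 - ρ)) s)) :
    shellWeightOfDatum₉ F N ϑ D g₀ os p g k ρ t s =
      mgf (T4GenFunBounds.prodObs (D.scheme g₀) p.K os)
        (shellMeasureOfSlots F N ϑ.ν ϑ.τ9 (wOfRecord₉ F N ϑ) p g (Missing.boltzmann (F.P p.K) ((g₀ p.K)⁻¹ ^ 2)) k (epsOfRecord ϑ.ν g k * (1 - ρ)) s) t := by
  have hsel' : ∀ (k : ℕ) (s : SeqOfRecord F ϑ.ν ϑ.τ9.M g p.K (k + 1)), ϑ.ppSel p g (k + 1) s = s := fun k s => by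
    rw [hsel]; rfl
  exact integral_shellDensity_mul_texpAOfRecordFrom_eq_mgf hsel' hw0 hwm hχm
    (Missing.measurable_boltzmann RegularGaugeGroup.measurable_reTr (F.P p.K) _) (fun U => (Missing.boltzmann_pos (F.P p.K) _ U).le)
    (T4GenFunBounds.measurable_prodObs (D.scheme g₀) (fun K o => D.measurable_avgObs hD K o) p.K os)
    (T4GenFunBounds.abs_prodObs_le_one (D.scheme g₀) (fun K o U => D.abs_avgObs_le_one K o U) p.K os) t (fun _ => rfl) k s hχm'

/-- **The tower identity for the shell part**: at a Stage-9 tuple PINNED AT THE LIVE SELECTOR OF RECORD (`ϑ.ppSel = ppSelLiveOfRecord … E (wOfRecord₉ ϑ)`), `g 0 = g₀ p.K`, measurable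
averagings and the displayed laws, N21's term shell part EQUALS the one at the identity re-pin `{ϑ with ppSel := ppSelIdOfRecord}` (n19-c's `dressedSlotsOfDatum₉_ppSelLive_eq_ppSelId`
under the integral — the top indicators do not read the selector). [folklore] -/
theorem shellWeightOfDatum₉_ppSelLive_eq_ppSelId (ϑ : Stage9Params F N) (E : B12.RunParams → ℝ)
    (hsel : ϑ.ppSel = ppSelLiveOfRecord F N ϑ.ν ϑ.τ9 E (wOfRecord₉ F N ϑ)) {p : B12.RunParams} {g : ℕ → ℝ} {g₀ : ℕ → ℝ} (hg : g 0 = g₀ p.K)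
    (D : FiniteEpsData F (Node00.SU N)) (hD : D.AvgMeasurable) (hw0 : ∀ k s' U V', 0 ≤ wOfRecord₉ F N ϑ p g k s' U V')
    (hwm : ∀ k s', Measurable fun z : GaugeField (F.P p.K) (k + 1) (Node00.SU N) × GaugeField (F.P p.K) k (Node00.SU N) => wOfRecord₉ F N ϑ p g k s' z.2 z.1)
    (hχm : ∀ k s, Measurable (chiSeqOfRecord F N ϑ.ν ϑ.τ9.M g p.K k s)) (os : List (ULoop F)) (k : ℕ) (ρ t : ℝ) (s : SeqOfRecord F ϑ.ν ϑ.τ9.M g p.K k) :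
    shellWeightOfDatum₉ F N ϑ D g₀ os p g k ρ t s = shellWeightOfDatum₉ F N { ϑ with ppSel := ppSelIdOfRecord F ϑ.ν ϑ.τ9.M } D g₀ os p g k ρ t s := by
  unfold shellWeightOfDatum₉
  refine integral_congr_ae (ae_of_all _ fun V => ?_)
  show chiSeqOfRecord F N ϑ.ν ϑ.τ9.M g p.K k s V * (1 - chiSeqOfRecordAt F N ϑ.ν ϑ.τ9.M g p.K k (epsOfRecord ϑ.ν g k * (1 - ρ)) s V) *
      dressedSlotsOfDatum₉ F N ϑ D g₀ os t p g k s V =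
    chiSeqOfRecord F N ϑ.ν ϑ.τ9.M g p.K k s V * (1 - chiSeqOfRecordAt F N ϑ.ν ϑ.τ9.M g p.K k (epsOfRecord ϑ.ν g k * (1 - ρ)) s V) *
      dressedSlotsOfDatum₉ F N { ϑ with ppSel := ppSelIdOfRecord F ϑ.ν ϑ.τ9.M } D g₀ os t p g k s V
  rw [dressedSlotsOfDatum₉_ppSelLive_eq_ppSelId F N ϑ D g₀ os p g E hsel hg hD hw0 hwm hχm t k s V]

/-- **★ N21's TERM SHELL PART IS AN MGF — AT THE LIVE SELECTOR OF RECORD** (`g 0 = g₀ p.K`; same shell measure as at the identity selector: neither the class nor the shell measure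
reads the selector). [folklore] -/
theorem shellWeightOfDatum₉_eq_mgf_of_ppSelLive (ϑ : Stage9Params F N) (E : B12.RunParams → ℝ)
    (hsel : ϑ.ppSel = ppSelLiveOfRecord F N ϑ.ν ϑ.τ9 E (wOfRecord₉ F N ϑ)) {p : B12.RunParams} {g : ℕ → ℝ} {g₀ : ℕ → ℝ} (hg : g 0 = g₀ p.K)
    (hw0 : ∀ k s' U V', 0 ≤ wOfRecord₉ F N ϑ p g k s' U V')
    (hwm : ∀ k s', Measurable fun z : GaugeField (F.P p.K) (k + 1) (Node00.SU N) × GaugeField (F.P p.K) k (Node00.SU N) => wOfRecord₉ F N ϑ p g k s' z.2 z.1)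
    (hχm : ∀ k s, Measurable (chiSeqOfRecord F N ϑ.ν ϑ.τ9.M g p.K k s)) (D : FiniteEpsData F (Node00.SU N)) (hD : D.AvgMeasurable)
    (os : List (ULoop F)) (k : ℕ) (ρ t : ℝ) (s : SeqOfRecord F ϑ.ν ϑ.τ9.M g p.K k)
    (hχm' : Measurable (chiSeqOfRecordAt F N ϑ.ν ϑ.τ9.M g p.K k (epsOfRecord ϑ.ν g k * (1 - ρ)) s)) :
    shellWeightOfDatum₉ F N ϑ D g₀ os p g k ρ t s =
      mgf (T4GenFunBounds.prodObs (D.scheme g₀) p.K os)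
        (shellMeasureOfSlots F N ϑ.ν ϑ.τ9 (wOfRecord₉ F N ϑ) p g (Missing.boltzmann (F.P p.K) ((g₀ p.K)⁻¹ ^ 2)) k (epsOfRecord ϑ.ν g k * (1 - ρ)) s) t := by
  rw [shellWeightOfDatum₉_ppSelLive_eq_ppSelId ϑ E hsel hg D hD hw0 hwm hχm os k ρ t s]
  exact shellWeightOfDatum₉_eq_mgf_of_ppSelId { ϑ with ppSel := ppSelIdOfRecord F ϑ.ν ϑ.τ9.M } rfl hw0 hwm hχm D hD g₀ os k ρ t s hχm'

end AtData

/-! ## §3 ★ AT THE SPINE READING OF RECORD: the SHELL MEASURES OF RECORD, `≤` the class measures of record, `MGFForm` of n21-d's `shellA₁₃ ∕ shellB₁₃`, and p593287 §4 with (SH) DISCHARGED -/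

section AtReading

open Summit.QuantumFields.YangMills.Theorems.N21ShellSplitOfRecord13CoPH (shellWeightOfDatum₉ shellA₁₃ shellB₁₃ shellSplitOfRecord₁₃At WidthLetter₁₃CoPH)
open Summit.QuantumFields.YangMills.BalabanUVNodes.N19MGFFormAtRecord (wOfRecord₉_nonneg wOfRecord₉_le_one)
open Summit.QuantumFields.BalabanUV.T4Continuum.NE1p.DressedMGFForm (MGFForm TiltedMeanMatching)
open Summit.QuantumFields.BalabanUV.T4Continuum.Spine
open YMDAG.UVSplit
open YMDAG.N14.AtSpineReading13CoPH

variable {F : T4Family} {N : ℕ} [NeZero N]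

/-- **RUN A's SHELL MEASURE OF RECORD** at step `K`, key `x`, relative width letter `ρ K`: the fibre sum along `keyA₁₃` of the shell measures of slots of run A at the
LOWERED threshold `ε_{K₀+K}(1 − ρ K)` — the measure-level companion of n21-d's `shellA₁₃`. [bookkeeping] -/
def shellMeasA₁₃ (θ : Stage13HParams F N) (K₀ : ℕ) (g₀ : ℕ → ℝ) (ρ : ℕ → ℝ) (K : ℕ) (x : Σ K, SiteSeqKey F (K₀ + K)) :
    Measure (GaugeField (F.P (K₀ + K)) 0 (Node00.SU N)) :=
  letI : ∀ Kc, DecidableEq (SiteSeqKey F Kc) := fun _ => Classical.decEq _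
  ∑ s ∈ univ.filter (fun s => keyA₁₃ θ K₀ g₀ K s = x),
    shellMeasureOfSlots F N θ.ν θ.τ9 (wOfRecord₉ F N θ.toStage9Params) (runA₁₃ F K₀ g₀ K) (histA₁₃ θ K₀ g₀ K)
      (Missing.boltzmann (F.P (K₀ + K)) ((g₀ (K₀ + K))⁻¹ ^ 2)) (K₀ + K) (epsOfRecord θ.ν (histA₁₃ θ K₀ g₀ K) (K₀ + K) * (1 - ρ K)) s

/-- **RUN B's SHELL MEASURE OF RECORD** (run `K₀ + K + 1`, block-down fibre of `keyB₁₃`) — the companion of `shellB₁₃`. [bookkeeping] -/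
def shellMeasB₁₃ (θ : Stage13HParams F N) (K₀ : ℕ) (g₀ : ℕ → ℝ) (ρ : ℕ → ℝ) (K : ℕ) (x : Σ K, SiteSeqKey F (K₀ + K)) :
    Measure (GaugeField (F.P (K₀ + K + 1)) 0 (Node00.SU N)) :=
  letI : ∀ Kc, DecidableEq (SiteSeqKey F Kc) := fun _ => Classical.decEq _
  ∑ s' ∈ univ.filter (fun s' => keyB₁₃ θ K₀ g₀ K s' = x),
    shellMeasureOfSlots F N θ.ν θ.τ9 (wOfRecord₉ F N θ.toStage9Params) (runB₁₃ F K₀ g₀ K) (histB₁₃ θ K₀ g₀ K)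
      (Missing.boltzmann (F.P (K₀ + K + 1)) ((g₀ (K₀ + K + 1))⁻¹ ^ 2)) (K₀ + K + 1) (epsOfRecord θ.ν (histB₁₃ θ K₀ g₀ K) (K₀ + K + 1) * (1 - ρ K)) s'

variable (θ : Stage13HParams F N) (K₀ : ℕ)

/-- **THE SHELL MEASURE OF RECORD IS A PART OF THE CLASS MEASURE OF RECORD** (run A): `shellMeasA₁₃ … ρ K x ≤ classMeasA₁₃ … K x` (summand-wise `shellMeasureOfSlots_le`; law (H-ζ) displayed,
(H-U) absolute). — p593287 §4's `hleA` at the shell split of record. [folklore] -/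
theorem shellMeasA₁₃_le (hζm : ZetaMeasurable F N θ.ζ) (g₀ : ℕ → ℝ) (ρ : ℕ → ℝ) (K : ℕ) (x : Σ K, SiteSeqKey F (K₀ + K)) :
    shellMeasA₁₃ θ K₀ g₀ ρ K x ≤ classMeasA₁₃ θ K₀ g₀ K x := by
  unfold shellMeasA₁₃ classMeasA₁₃
  exact Finset.sum_le_sum fun s _ => shellMeasureOfSlots_le
    (fun k s' => measurable_wOfRecord_of_localBg (localBgMeasurable F N θ.ν) _ _ hζm _ _ k s')
    (fun k s => measurable_chiSeqOfRecord_of_localBg (localBgMeasurable F N θ.ν) _ _ _ k s)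
    (Missing.measurable_boltzmann RegularGaugeGroup.measurable_reTr (F.P (runA₁₃ F K₀ g₀ K).K) _) (K₀ + K) _ s
/-- … and run B: `shellMeasB₁₃ … ≤ classMeasB₁₃ …` — p593287 §4's `hleB`. [folklore] -/
theorem shellMeasB₁₃_le (hζm : ZetaMeasurable F N θ.ζ) (g₀ : ℕ → ℝ) (ρ : ℕ → ℝ) (K : ℕ) (x : Σ K, SiteSeqKey F (K₀ + K)) :
    shellMeasB₁₃ θ K₀ g₀ ρ K x ≤ classMeasB₁₃ θ K₀ g₀ K x := by
  unfold shellMeasB₁₃ classMeasB₁₃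
  exact Finset.sum_le_sum fun s' _ => shellMeasureOfSlots_le
    (fun k s' => measurable_wOfRecord_of_localBg (localBgMeasurable F N θ.ν) _ _ hζm _ _ k s')
    (fun k s => measurable_chiSeqOfRecord_of_localBg (localBgMeasurable F N θ.ν) _ _ _ k s)
    (Missing.measurable_boltzmann RegularGaugeGroup.measurable_reTr (F.P (runB₁₃ F K₀ g₀ K).K) _) (K₀ + K + 1) _ s'

/-- Run A's shell measures of record are FINITE (parts of finite measures). [folklore] -/
theorem isFiniteMeasure_shellMeasA₁₃ (hP : θ.Provisos₁₃CoPH F N) (hζm : ZetaMeasurable F N θ.ζ) (g₀ : ℕ → ℝ) (ρ : ℕ → ℝ) (K : ℕ) (x : Σ K, SiteSeqKey F (K₀ + K)) :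
    IsFiniteMeasure (shellMeasA₁₃ θ K₀ g₀ ρ K x) := by
  haveI := isFiniteMeasure_classMeasA₁₃ θ K₀ hP hζm g₀ K x
  exact isFiniteMeasure_of_le _ (shellMeasA₁₃_le θ K₀ hζm g₀ ρ K x)
/-- Run B's shell measures of record are FINITE. [folklore] -/
theorem isFiniteMeasure_shellMeasB₁₃ (hP : θ.Provisos₁₃CoPH F N) (hζm : ZetaMeasurable F N θ.ζ) (g₀ : ℕ → ℝ) (ρ : ℕ → ℝ) (K : ℕ) (x : Σ K, SiteSeqKey F (K₀ + K)) :
    IsFiniteMeasure (shellMeasB₁₃ θ K₀ g₀ ρ K x) := by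
  haveI := isFiniteMeasure_classMeasB₁₃ θ K₀ hP hζm g₀ K x
  exact isFiniteMeasure_of_le _ (shellMeasB₁₃_le θ K₀ hζm g₀ ρ K x)
/-- **★ `MGFForm` OF n21-d's KEYED SHELL PART OF RECORD `shellA₁₃`** over the shell measures of record (observable `prodObs (…) (K₀ + K) os`, `Bo = 1`, classes `classSet₁₃`), AT THE
LIVE SELECTOR under the displayed laws (H-ζ) ∕ `0 ≤ ζ` — §2 per sequence (`histA₁₃_zero`) + `integral_finsetSum_measure` over the σ-packed fibre.  This IS p593287 §4's `hshA` at
`sh := shellSplitOfRecord₁₃At N K₀ ρA ρB` (`ρ := ρA F θ hP g₀ os`; n21-d's `shellSplitOfRecord₁₃At_fst`). [folklore] -/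
theorem mgfForm_shellA₁₃ (hP : θ.Provisos₁₃CoPH F N) (E : B12.RunParams → ℝ)
    (hsel : θ.ppSel = ppSelLiveOfRecord F N θ.ν θ.τ9 E (wOfRecord₉ F N θ.toStage9Params))
    (hζm : ZetaMeasurable F N θ.ζ) (hζ0 : ∀ p g k s Pl Ql RS U V', 0 ≤ θ.ζ p g k s Pl Ql RS U V') (g₀ : ℕ → ℝ) (os : List (ULoop F)) (ρ : ℕ → ℝ) :
    MGFForm 1 (classSet₁₃ θ K₀ g₀)
      (fun K (U : GaugeField (F.P (K₀ + K)) 0 (Node00.SU N)) => T4GenFunBounds.prodObs ((datumOfRecord₁₃CoPH F N θ hP).scheme g₀) (K₀ + K) os U)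
      (shellMeasA₁₃ θ K₀ g₀ ρ) (shellA₁₃ θ hP K₀ g₀ os ρ) where
  nonneg := zero_le_one
  meas K := measurable_prodObs_datumOfRecord₁₃CoPH θ hP g₀ os (K₀ + K)
  bound K ω := abs_prodObs_datumOfRecord₁₃CoPH_le_one θ hP g₀ os (K₀ + K) ω
  finite K x _ := isFiniteMeasure_shellMeasA₁₃ θ K₀ hP hζm g₀ ρ K x
  repr K t x _ := by
    letI : ∀ Kc, DecidableEq (SiteSeqKey F Kc) := fun _ => Classical.decEq _
    have hU := localBgMeasurable F N θ.ν
    have hwm : ∀ k s', Measurable fun z : GaugeField (F.P (runA₁₃ F K₀ g₀ K).K) (k + 1) (Node00.SU N) × GaugeField (F.P (runA₁₃ F K₀ g₀ K).K) k (Node00.SU N) =>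
        wOfRecord₉ F N θ.toStage9Params (runA₁₃ F K₀ g₀ K) (histA₁₃ θ K₀ g₀ K) k s' z.2 z.1 :=
      fun k s' => measurable_wOfRecord_of_localBg hU _ _ hζm _ _ k s'
    have hχm : ∀ k s, Measurable (chiSeqOfRecord F N θ.ν θ.τ9.M (histA₁₃ θ K₀ g₀ K) (runA₁₃ F K₀ g₀ K).K k s) :=
      fun k s => measurable_chiSeqOfRecord_of_localBg hU _ _ _ k s
    have hfin : ∀ s : SeqOfRecord F θ.ν θ.τ9.M (histA₁₃ θ K₀ g₀ K) (K₀ + K) (K₀ + K),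
        IsFiniteMeasure (α := GaugeField (F.P (K₀ + K)) 0 (Node00.SU N))
          (shellMeasureOfSlots F N θ.ν θ.τ9 (wOfRecord₉ F N θ.toStage9Params) (runA₁₃ F K₀ g₀ K) (histA₁₃ θ K₀ g₀ K)
            (Missing.boltzmann (F.P (K₀ + K)) ((g₀ (K₀ + K))⁻¹ ^ 2)) (K₀ + K) (epsOfRecord θ.ν (histA₁₃ θ K₀ g₀ K) (K₀ + K) * (1 - ρ K)) s) := fun s =>
      @isFiniteMeasure_of_le _ _ _ _ (isFiniteMeasure_classMeasureOfSlots_runA₁₃ θ K₀ hP hζm g₀ K s)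
        (shellMeasureOfSlots_le hwm hχm (Missing.measurable_boltzmann RegularGaugeGroup.measurable_reTr (F.P (runA₁₃ F K₀ g₀ K).K) _) (K₀ + K) _ s)
    have hint : ∀ s ∈ univ.filter (fun s => keyA₁₃ θ K₀ g₀ K s = x),
        Integrable (fun ω : GaugeField (F.P (K₀ + K)) 0 (Node00.SU N) =>
            Real.exp (t * T4GenFunBounds.prodObs ((datumOfRecord₁₃CoPH F N θ hP).scheme g₀) (K₀ + K) os ω))
          (shellMeasureOfSlots F N θ.ν θ.τ9 (wOfRecord₉ F N θ.toStage9Params) (runA₁₃ F K₀ g₀ K) (histA₁₃ θ K₀ g₀ K)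
            (Missing.boltzmann (F.P (K₀ + K)) ((g₀ (K₀ + K))⁻¹ ^ 2)) (K₀ + K) (epsOfRecord θ.ν (histA₁₃ θ K₀ g₀ K) (K₀ + K) * (1 - ρ K)) s) := fun s _ =>
      @T4GenFunBounds.integrable_exp_mul_of_bound _ _ _ _ _ (hfin s)
        (measurable_prodObs_datumOfRecord₁₃CoPH θ hP g₀ os (K₀ + K)).aemeasurable
        (ae_of_all _ (abs_prodObs_datumOfRecord₁₃CoPH_le_one θ hP g₀ os (K₀ + K))) t
    unfold shellA₁₃ shellMeasA₁₃
    refine (Finset.sum_congr rfl fun s _ => ?_).trans (integral_finsetSum_measure hint).symm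
    exact shellWeightOfDatum₉_eq_mgf_of_ppSelLive θ.toStage9Params E hsel (histA₁₃_zero θ K₀ g₀ K) (wOfRecord₉_nonneg _ hζ0 _ _) hwm hχm
      (datumOfRecord₁₃CoPH F N θ hP) (isPrintedAveraged_datumOfRecord₁₃CoPH F N θ hP).avgMeasurable os (K₀ + K) (ρ K) t s
      (measurable_chiSeqOfRecordAt_of_localBg hU _ _ _ _ _ s)

/-- **★ `MGFForm` OF n21-d's KEYED SHELL PART OF RECORD `shellB₁₃`** (run `K₀ + K + 1`, block-down fibre; `histB₁₃_zero`) — p593287 §4's `hshB` at `sh := shellSplitOfRecord₁₃At N K₀ ρA ρB`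
(`ρ := ρB F θ hP g₀ os`; n21-d's `shellSplitOfRecord₁₃At_snd`). [folklore] -/
theorem mgfForm_shellB₁₃ (hP : θ.Provisos₁₃CoPH F N) (E : B12.RunParams → ℝ)
    (hsel : θ.ppSel = ppSelLiveOfRecord F N θ.ν θ.τ9 E (wOfRecord₉ F N θ.toStage9Params))
    (hζm : ZetaMeasurable F N θ.ζ) (hζ0 : ∀ p g k s Pl Ql RS U V', 0 ≤ θ.ζ p g k s Pl Ql RS U V') (g₀ : ℕ → ℝ) (os : List (ULoop F)) (ρ : ℕ → ℝ) :
    MGFForm 1 (classSet₁₃ θ K₀ g₀)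
      (fun K (U : GaugeField (F.P (K₀ + K + 1)) 0 (Node00.SU N)) => T4GenFunBounds.prodObs ((datumOfRecord₁₃CoPH F N θ hP).scheme g₀) (K₀ + K + 1) os U)
      (shellMeasB₁₃ θ K₀ g₀ ρ) (shellB₁₃ θ hP K₀ g₀ os ρ) where
  nonneg := zero_le_one
  meas K := measurable_prodObs_datumOfRecord₁₃CoPH θ hP g₀ os (K₀ + K + 1)
  bound K ω := abs_prodObs_datumOfRecord₁₃CoPH_le_one θ hP g₀ os (K₀ + K + 1) ω
  finite K x _ := isFiniteMeasure_shellMeasB₁₃ θ K₀ hP hζm g₀ ρ K x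
  repr K t x _ := by
    letI : ∀ Kc, DecidableEq (SiteSeqKey F Kc) := fun _ => Classical.decEq _
    have hU := localBgMeasurable F N θ.ν
    have hwm : ∀ k s', Measurable fun z : GaugeField (F.P (runB₁₃ F K₀ g₀ K).K) (k + 1) (Node00.SU N) × GaugeField (F.P (runB₁₃ F K₀ g₀ K).K) k (Node00.SU N) =>
        wOfRecord₉ F N θ.toStage9Params (runB₁₃ F K₀ g₀ K) (histB₁₃ θ K₀ g₀ K) k s' z.2 z.1 :=
      fun k s' => measurable_wOfRecord_of_localBg hU _ _ hζm _ _ k s'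
    have hχm : ∀ k s, Measurable (chiSeqOfRecord F N θ.ν θ.τ9.M (histB₁₃ θ K₀ g₀ K) (runB₁₃ F K₀ g₀ K).K k s) :=
      fun k s => measurable_chiSeqOfRecord_of_localBg hU _ _ _ k s
    have hfin : ∀ s : SeqOfRecord F θ.ν θ.τ9.M (histB₁₃ θ K₀ g₀ K) (K₀ + K + 1) (K₀ + K + 1),
        IsFiniteMeasure (α := GaugeField (F.P (K₀ + K + 1)) 0 (Node00.SU N))
          (shellMeasureOfSlots F N θ.ν θ.τ9 (wOfRecord₉ F N θ.toStage9Params) (runB₁₃ F K₀ g₀ K) (histB₁₃ θ K₀ g₀ K)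
            (Missing.boltzmann (F.P (K₀ + K + 1)) ((g₀ (K₀ + K + 1))⁻¹ ^ 2)) (K₀ + K + 1) (epsOfRecord θ.ν (histB₁₃ θ K₀ g₀ K) (K₀ + K + 1) * (1 - ρ K)) s) := fun s =>
      @isFiniteMeasure_of_le _ _ _ _ (isFiniteMeasure_classMeasureOfSlots_runB₁₃ θ K₀ hP hζm g₀ K s)
        (shellMeasureOfSlots_le hwm hχm (Missing.measurable_boltzmann RegularGaugeGroup.measurable_reTr (F.P (runB₁₃ F K₀ g₀ K).K) _) (K₀ + K + 1) _ s)
    have hint : ∀ s ∈ univ.filter (fun s => keyB₁₃ θ K₀ g₀ K s = x),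
        Integrable (fun ω : GaugeField (F.P (K₀ + K + 1)) 0 (Node00.SU N) =>
            Real.exp (t * T4GenFunBounds.prodObs ((datumOfRecord₁₃CoPH F N θ hP).scheme g₀) (K₀ + K + 1) os ω))
          (shellMeasureOfSlots F N θ.ν θ.τ9 (wOfRecord₉ F N θ.toStage9Params) (runB₁₃ F K₀ g₀ K) (histB₁₃ θ K₀ g₀ K)
            (Missing.boltzmann (F.P (K₀ + K + 1)) ((g₀ (K₀ + K + 1))⁻¹ ^ 2)) (K₀ + K + 1) (epsOfRecord θ.ν (histB₁₃ θ K₀ g₀ K) (K₀ + K + 1) * (1 - ρ K)) s) := fun s _ =>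
      @T4GenFunBounds.integrable_exp_mul_of_bound _ _ _ _ _ (hfin s)
        (measurable_prodObs_datumOfRecord₁₃CoPH θ hP g₀ os (K₀ + K + 1)).aemeasurable
        (ae_of_all _ (abs_prodObs_datumOfRecord₁₃CoPH_le_one θ hP g₀ os (K₀ + K + 1))) t
    unfold shellB₁₃ shellMeasB₁₃
    refine (Finset.sum_congr rfl fun s _ => ?_).trans (integral_finsetSum_measure hint).symm
    exact shellWeightOfDatum₉_eq_mgf_of_ppSelLive θ.toStage9Params E hsel (histB₁₃_zero θ K₀ g₀ K) (wOfRecord₉_nonneg _ hζ0 _ _) hwm hχm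
      (datumOfRecord₁₃CoPH F N θ hP) (isPrintedAveraged_datumOfRecord₁₃CoPH F N θ hP).avgMeasurable os (K₀ + K + 1) (ρ K) t s
      (measurable_chiSeqOfRecordAt_of_localBg hU _ _ _ _ _ s)


/-- **★★ p593287 §4 WITH (SH) DISCHARGED AT THE SHELL SPLIT OF RECORD — N19′ ∧ U4′ AT THE READING `crOfRecord₁₃At K₀ jcut (shellSplitOfRecord₁₃At N K₀ ρA ρB)`, CANONICAL RATE.**
At one Stage-13 tuple with core provisos on the live-selector line (laws (H-ζ) ∕ `0 ≤ ζ` displayed), for n21-d's shell split of record with ANY width letters `ρA ρB`, the TWO displayed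
hypotheses — each produced by nobody — are: (V) §N19 s1's bracket on the VACUUM shell-free class weights of record `weightA₁₃ − shellA₁₃`, `weightB₁₃ − shellB₁₃` (`t = 0`), summable
`δ₀`; (I) node U3's READ-OUT SENTENCE, TV currency, for the SHELL-FREE class laws of record `classMeasA₁₃ − shellMeasA₁₃` ∕ `classMeasB₁₃ − shellMeasB₁₃` pushed to the unit lattice,
width `ρ K`, `Σ ρ K < ∞`.  CONCLUSION: `NE7.Core` at the reading's OWN `l₀ ∕ vol ∕ T ∕ Bad ∕ A − shA ∕ B − shB` and CANONICAL `δ`, `∧ Summable` — what K3⁷ v2 stub 2's N19′ conjunct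
`KeyedCoreEdgeHolderD4 β (crOfRecord₁₃ jcut (shellSplitOfRecord₁₃At 2 0 ρA ρB)) rr` asks at a live tuple, rates NOT read (p593287 `core_crOfRecord₁₃At_of_coreZero_of_tv` with
`hshA ∕ hleA ∕ hshB ∕ hleB :=` §3 BY NAME; the ∃δ-form at the record letters is p593287 `coreEdge_reading₁₃_of_coreZero_of_tv` fed the same way). [folklore] -/
theorem core_crOfRecord₁₃At_shellSplitOfRecord_of_coreZero_of_tv (hP : θ.Provisos₁₃CoPH F N) (jcut : ℕ → ℕ) (ρA ρB : WidthLetter₁₃CoPH N)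
    (E : B12.RunParams → ℝ) (hsel : θ.ppSel = ppSelLiveOfRecord F N θ.ν θ.τ9 E (wOfRecord₉ F N θ.toStage9Params))
    (hζm : ZetaMeasurable F N θ.ζ) (hζ0 : ∀ p g k s Pl Ql RS U V', 0 ≤ θ.ζ p g k s Pl Ql RS U V') (g₀ : ℕ → ℝ) (os : List (ULoop F)) {δ₀ ρ : ℕ → ℝ}
    (h0 : letI : DecidableEq (Σ K, SiteSeqKey F (K₀ + K)) := Classical.decEq _
      NE7.Core 1 1 (classSet₁₃ θ K₀ g₀) (badClass₁₃ θ K₀ g₀ jcut)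
        (fun K _ x => weightA₁₃ θ hP K₀ g₀ os K 0 x - shellA₁₃ θ hP K₀ g₀ os (ρA F θ hP g₀ os) K 0 x)
        (fun K _ x => weightB₁₃ θ hP K₀ g₀ os K 0 x - shellB₁₃ θ hP K₀ g₀ os (ρB F θ hP g₀ os) K 0 x) δ₀)
    (hδ₀ : Summable δ₀)
    (hTV : letI : DecidableEq (Σ K, SiteSeqKey F (K₀ + K)) := Classical.decEq _
      ∀ (K : ℕ) (t : ℝ), |t| ≤ 1 → ∀ x ∈ classSet₁₃ θ K₀ g₀ K \ badClass₁₃ θ K₀ g₀ jcut K t, ∀ S : Set (GaugeField (F.P 0) 0 (Node00.SU N)), MeasurableSet S →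
        |((classMeasB₁₃ θ K₀ g₀ K x - shellMeasB₁₃ θ K₀ g₀ (ρB F θ hP g₀ os) K x).map
              ((T4RunLadder.unitFactorisation (datumOfRecord₁₃CoPH F N θ hP) (isPrintedAveraged_datumOfRecord₁₃CoPH F N θ hP).avgMeasurable g₀).A (K₀ + K + 1))).real S /
            ((classMeasB₁₃ θ K₀ g₀ K x - shellMeasB₁₃ θ K₀ g₀ (ρB F θ hP g₀ os) K x).map
              ((T4RunLadder.unitFactorisation (datumOfRecord₁₃CoPH F N θ hP) (isPrintedAveraged_datumOfRecord₁₃CoPH F N θ hP).avgMeasurable g₀).A (K₀ + K + 1))).real Set.univ -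
          ((classMeasA₁₃ θ K₀ g₀ K x - shellMeasA₁₃ θ K₀ g₀ (ρA F θ hP g₀ os) K x).map
              ((T4RunLadder.unitFactorisation (datumOfRecord₁₃CoPH F N θ hP) (isPrintedAveraged_datumOfRecord₁₃CoPH F N θ hP).avgMeasurable g₀).A (K₀ + K))).real S /
            ((classMeasA₁₃ θ K₀ g₀ K x - shellMeasA₁₃ θ K₀ g₀ (ρA F θ hP g₀ os) K x).map
              ((T4RunLadder.unitFactorisation (datumOfRecord₁₃CoPH F N θ hP) (isPrintedAveraged_datumOfRecord₁₃CoPH F N θ hP).avgMeasurable g₀).A (K₀ + K))).real Set.univ| ≤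
          ρ K)
    (hρs : Summable ρ) :
    (letI := (crOfRecord₁₃At K₀ jcut (shellSplitOfRecord₁₃At N K₀ ρA ρB) F θ hP g₀ os).dec
     NE7.Core (crOfRecord₁₃At K₀ jcut (shellSplitOfRecord₁₃At N K₀ ρA ρB) F θ hP g₀ os).l₀ (crOfRecord₁₃At K₀ jcut (shellSplitOfRecord₁₃At N K₀ ρA ρB) F θ hP g₀ os).vol
      (crOfRecord₁₃At K₀ jcut (shellSplitOfRecord₁₃At N K₀ ρA ρB) F θ hP g₀ os).T (crOfRecord₁₃At K₀ jcut (shellSplitOfRecord₁₃At N K₀ ρA ρB) F θ hP g₀ os).Bad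
      (fun K t τ => (crOfRecord₁₃At K₀ jcut (shellSplitOfRecord₁₃At N K₀ ρA ρB) F θ hP g₀ os).A K t τ -
        (crOfRecord₁₃At K₀ jcut (shellSplitOfRecord₁₃At N K₀ ρA ρB) F θ hP g₀ os).shA K t τ)
      (fun K t τ => (crOfRecord₁₃At K₀ jcut (shellSplitOfRecord₁₃At N K₀ ρA ρB) F θ hP g₀ os).B K t τ -
        (crOfRecord₁₃At K₀ jcut (shellSplitOfRecord₁₃At N K₀ ρA ρB) F θ hP g₀ os).shB K t τ)
      (crOfRecord₁₃At K₀ jcut (shellSplitOfRecord₁₃At N K₀ ρA ρB) F θ hP g₀ os).δ) ∧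
      Summable (crOfRecord₁₃At K₀ jcut (shellSplitOfRecord₁₃At N K₀ ρA ρB) F θ hP g₀ os).δ :=
  core_crOfRecord₁₃At_of_coreZero_of_tv θ hP K₀ jcut (shellSplitOfRecord₁₃At N K₀ ρA ρB) E hsel hζm hζ0 g₀ os h0 hδ₀
    (mgfForm_shellA₁₃ θ K₀ hP E hsel hζm hζ0 g₀ os (ρA F θ hP g₀ os)) (fun K x _ => shellMeasA₁₃_le θ K₀ hζm g₀ (ρA F θ hP g₀ os) K x)
    (mgfForm_shellB₁₃ θ K₀ hP E hsel hζm hζ0 g₀ os (ρB F θ hP g₀ os)) (fun K x _ => shellMeasB₁₃_le θ K₀ hζm g₀ (ρB F θ hP g₀ os) K x) hTV hρs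

end AtReading

end YMDAG.N14.AtSpineReading13CoPH.Shell

end
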